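import Mathlib.Analysis.SpecialFunctions.Log.Basic
import Mathlib.Tactic
import Summits.KontsevichZagierPeriods.Zeta5Search.Criteria
import Summits.KontsevichZagierPeriods.Zeta5Search.SymmetricFamilyMargin
import Summits.KontsevichZagierPeriods.Zeta5Search.CatalanFamilyCertificates
import HarnessLib

/-!
# ζ(5) search — the two calibration near-misses admit no `LinearFormCertificate` with their natural denominators

HONEST FRAMING: systematic search; no irrationality claim unless certified.

Cell `pub-zeta5` (summit KontsevichZagierPeriods, topic Zeta5Search), seat P1. The cell's certificate type is
`LinearFormCertificate ξ` (`Criteria.lean`, typer): forms `ℓ_n`, denominators `D_n ≤ e^{δn}`, savings `Φ_n ≥ e^{φn}`,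
decay `|ℓ_n| ≤ e^{-cn}`, and the margin `δ < c + φ`. This file records, in that exact vocabulary, the NEGATIVE content
of the two families certified by this seat, conditional on the published rates (named facts) and the tree's PNT:

* `no_certificate_symmetric` — for the totally symmetric cellular family (forms `I'_n = Q_nζ(5) - P_n`,
  `Literature…BrownZudilin2022.TotallySymmetric`), under `BrownZudilin2022.rates` and eventual non-vanishing of the forms:
  there is NO `LinearFormCertificate (zetaValue 5)` whose forms are the `I'_n`, whose denominators are the family's
  `12·lcm(1..n)⁵` and whose savings are bounded (`Φ_n ≤ K`) — because any decay exponent `c` and denominator exponent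
  `δ` of this family satisfy `c - δ < -2.527` (`SymmetricFamily.margin_lt`) while bounded savings force `φ ≤ 0`.
* `no_certificate_catalan` — the same for Zudilin's 2003 Catalan family (forms `u_nG - v_n`, denominators
  `2^{4n} lcm(1..2n-1)²`, the observed ones) under `Zudilin2003.rates`: `c - δ < -4.366` (`CatalanFamily.margin_lt`).

These are theorems about the FAMILIES (they cannot certify), not about `ζ(5)` or `G`; a certificate with genuinely
growing savings `Φ_n` (rate `φ > 2.53`, resp. `> 4.37`) is not excluded by them — and is not observed
(`SymmetricFamilyCertificates.denominators`, `CatalanFamilyCertificates.two_adic_and_sharpness`: no savings beyond constants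
on the certified ranges).
-/

noncomputable section

namespace Summit.KontsevichZagierPeriods.Zeta5Search

open Filter Set
open scoped Topology
open Literature.NumberTheory.Irrationality
open Literature.NumberTheory.Transcendental (zetaValue catalanConstant)

/-- Bounded savings have non-positive rate: if `e^{φ n} ≤ Φ_n ≤ K` for all large `n` then `φ ≤ 0`. -/
theorem savingRate_nonpos_of_bounded {φ : ℝ} {Φ : ℕ → ℕ} {K : ℕ}
    (hle : ∀ᶠ n : ℕ in atTop, Real.exp (φ * n) ≤ Φ n) (hK : ∀ n, Φ n ≤ K) : φ ≤ 0 := by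
  by_contra hφ
  push Not at hφ
  -- `e^{φ n} → ∞`, contradiction with `≤ K`
  have hK' : ∀ᶠ n : ℕ in atTop, Real.exp (φ * n) ≤ K := by
    filter_upwards [hle] with n hn
    exact hn.trans (by exact_mod_cast hK n)
  have htend : Tendsto (fun n : ℕ => Real.exp (φ * n)) atTop atTop :=
    Real.tendsto_exp_atTop.comp (tendsto_natCast_atTop_atTop.const_mul_atTop hφ)
  obtain ⟨n, hn1, hn2⟩ := (hK'.and (htend.eventually_gt_atTop (K : ℝ))).exists
  linarith

/-- **No certificate from the totally symmetric family with its natural denominators.** Under the published rate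
(`BrownZudilin2022.rates`) and eventual non-vanishing of the forms `I'_n = Q_nζ(5) - P_n`, no
`LinearFormCertificate (zetaValue 5)` has `form = I'`, `denom n = 12·lcm(1..n)⁵` and bounded savings. -/
theorem no_certificate_symmetric (h : BrownZudilin2022.rates)
    (hne : ∀ᶠ n : ℕ in atTop, (BrownZudilin2022.Q n : ℝ) * zetaValue 5 - (BrownZudilin2022.P n : ℝ) ≠ 0)
    (K : ℕ) :
    ¬ ∃ cert : LinearFormCertificate (zetaValue 5),
        (∀ n, cert.form n = (BrownZudilin2022.Q n : ℝ) * zetaValue 5 - (BrownZudilin2022.P n : ℝ))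
        ∧ (∀ n, cert.denom n = 12 * Nat.lcmUpto n ^ 5) ∧ (∀ n, cert.saving n ≤ K) := by
  rintro ⟨cert, hform, hden, hsav⟩
  -- decay and denominator exponents of the certificate are exponents for the family
  have hc : ∀ᶠ n : ℕ in atTop, |(BrownZudilin2022.Q n : ℝ) * zetaValue 5 - (BrownZudilin2022.P n : ℝ)|
      ≤ Real.exp (-(cert.decayRate * n)) := by
    filter_upwards [cert.decay] with n hn
    rwa [hform n] at hn
  have hδ : ∀ᶠ n : ℕ in atTop, ((Nat.lcmUpto n : ℝ)) ^ 5 ≤ Real.exp (cert.denomRate * n) := by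
    filter_upwards [cert.denom_le] with n hn
    rw [hden n] at hn
    push_cast at hn
    have h0 : (0 : ℝ) ≤ (Nat.lcmUpto n : ℝ) ^ 5 := by positivity
    linarith
  have hmargin := SymmetricFamily.margin_lt h hne hc hδ
  have hφ := savingRate_nonpos_of_bounded cert.le_saving hsav
  have hpos := cert.margin_pos
  linarith

/-- **No certificate from Zudilin's Catalan family with the observed denominators.** Under `Zudilin2003.rates`, no
`LinearFormCertificate catalanConstant` has `form n = u_nG - v_n`, `denom n = 2^{4n}·lcm(1..2n-1)²` and bounded savings. -/
theorem no_certificate_catalan (h : Zudilin2003.rates) (K : ℕ) :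
    ¬ ∃ cert : LinearFormCertificate catalanConstant,
        (∀ n, cert.form n = Zudilin2003.form n)
        ∧ (∀ n, cert.denom n = 2 ^ (4 * n) * Nat.lcmUpto (2 * n - 1) ^ 2) ∧ (∀ n, cert.saving n ≤ K) := by
  rintro ⟨cert, hform, hden, hsav⟩
  have hc : ∀ᶠ n : ℕ in atTop, |Zudilin2003.form n| ≤ Real.exp (-(cert.decayRate * n)) := by
    filter_upwards [cert.decay] with n hn
    rwa [hform n] at hn
  have hδ : ∀ᶠ n : ℕ in atTop,
      (2 : ℝ) ^ (4 * n) * (Nat.lcmUpto (2 * n - 1) : ℝ) ^ 2 ≤ Real.exp (cert.denomRate * n) := by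
    filter_upwards [cert.denom_le] with n hn
    rw [hden n] at hn
    push_cast at hn
    exact hn
  have hmargin := CatalanFamily.margin_lt h hc hδ
  have hφ := savingRate_nonpos_of_bounded cert.le_saving hsav
  have hpos := cert.margin_pos
  linarith

end Summit.KontsevichZagierPeriods.Zeta5Search
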